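import Literature.MathematicalPhysics.QuantumFieldTheory.Balaban1983to89.Node00.Record13CoPH
import Literature.MathematicalPhysics.QuantumFieldTheory.Balaban1983to89.Node00.Record13Chi

/-!
# NODE 00 — [Ax-3c] of WORK ORDER RC-1 (director-ym №467 (ii) «L-gen»; CRIT-1 g33 RULING Q-3 (iii)): the HISTORY-INDEXED (CoPH) Stage-13 layer of
# `Node00/Record13CoPH` §0b–§3 RE-ISSUED GENERIC IN THE β-SLOT χ — `Stage13HParams.zhAtChi ∕ rzAtChi`, `WtOfRecord₁₃HChi`, `Stage13HParams.Provisos₁₃CoPHChi`,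
# `S218∕ScorrLaw∕SLaw∕TLaw∕VOfRecord₁₃CoPHChi`, `residualOfStage13CoPHChi`, `coreOfRecord₁₃CoPHChi`, `towerOfRecord₁₃CoPHChi`, `datumOfRecord₁₃CoPHChi` + row lemmas
# and faces — verbatim bodies over `[Ax-3b]`'s χ-generic Record13 layer (`Node00/Record13Chi`), with receipts at `χ := chiβOfRecord₁₃ θ` and the Ax instances

CITATION HEADER.  [I] = [Balaban1987RG1] (CMP **109**) (0.19) p.255, (1.20)–(1.22) p.264, (2.9) p.266; [III] = [Balaban1988Convergent] (2.18) p.257, (3.23) p.270,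
Thm 1 p.262; [IV] = [Balaban1989LargeFieldI] (0.2)–(0.4) p.176.  Every declaration below is the VERBATIM body of the like-named declaration of
`Node00/Record13CoPH.lean` (lines 308–760) with EXACTLY the substitutions of `Node00/Record13Chi` (binder `(χ : ChiSlot F N)` after `θ`; Record13-layer names
`X F N θ.toStage13Params ↦ XChi F N θ.toStage13Params χ`; `chiβOfRecord₁₃ … ↦ χ`; names `X ↦ XChi`, row lemmas `↦ …_chi`; zetaMeas autoParam default dropped).
NOTHING of record is edited (body-freeze №460 (2)); hands: porter PT-A-2 (`ymgap-nodeO-port-PTA-2`); custodians node00 def-Y∕def-T∕K0e.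
HONEST FRAMING.  Definitions re-issued over a parameter + receipts; provisos stay HYPOTHESES; nothing of Bałaban's asserted, ported or discharged; K0⁷∕K1⁹∕K3⁸ AS
VETTED read the choice-centred cut-off; no `sorry`∕`instance`∕`notation`; standard axioms; the YM mass gap (Clay) is NOT proved by any of this.
-/

noncomputable section

open MeasureTheory
open scoped Matrix.Norms.L2Operator

namespace Literature.MathematicalPhysics.QuantumFieldTheory.Balaban1983to89.Node00

open T4Continuum AveragingRT T4FiniteEpsInhabited FlowStep FlowStepRuns DagBinding T4DatumAssembly
open B12Eq019ActionBody (integrand)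

variable (F : T4Family) (N : ℕ) [NeZero N]

/-- **THE BACKGROUND MAPS OF RECORD, Stage 13** — FILE 12b's two-case carrier along the ₁₃ history: level 0 the print's `U₀(𝐖) := 𝐖 0`, level `n+1` def-R's
`UbgMSCoPOfRecordB` (print's multi-scale class, the (2.12) constraint read on PRINT's datum `lamBondsSeq` [II] (2.3) — (E1) variant (iii-b) of record,
director-ym №338∕№339 (α)∕№343 (D1): the Stage-2 re-point `UbgMSCoPOfRecord ↦ UbgMSCoPOfRecordB`, type unchanged).
[cite: Balaban1988Convergent, Thm 1 p.262, (2.12)–(2.13) pp.256–257; Balaban1984PropagatorsII, (2.3) p.224; Balaban1985AveragingOps, (6)∕(8) p.278] -/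
def UbgOfRecord₁₃CoPChi (θ : Stage13Params F N) (χ : ChiSlot F N) (p : B12.RunParams) :
    (n : ℕ) → (SeqOfRecord F θ.ν θ.τ9.M (gOfRecord₁₃Chi F N θ χ p) p.K n → BgMap F N p.K)
  | 0 => fun _ W => W 0
  | n + 1 => UbgMSCoPOfRecordB F N θ.ν θ.τ9.M (gOfRecord₁₃Chi F N θ χ p) p.K (n + 1)

/-- LEVEL 0: the background map of record IS the scale-0 field (`rfl`). [cite: Balaban1988Convergent, Thm 1 p.262] -/
theorem UbgOfRecord₁₃CoP_zero_chi (θ : Stage13Params F N) (χ : ChiSlot F N) (p : B12.RunParams) : UbgOfRecord₁₃CoPChi F N θ χ p 0 = fun _ W => W 0 := rfl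

/-- LEVEL `n + 1`: def-R's multi-scale background map of record over PRINT's datum (`rfl`). [cite: Balaban1988Convergent, (2.12)–(2.13) pp.256–257; Balaban1984PropagatorsII, (2.3) p.224] -/
theorem UbgOfRecord₁₃CoP_succ_chi (θ : Stage13Params F N) (χ : ChiSlot F N) (p : B12.RunParams) (n : ℕ) :
    UbgOfRecord₁₃CoPChi F N θ χ p (n + 1) = UbgMSCoPOfRecordB F N θ.ν θ.τ9.M (gOfRecord₁₃Chi F N θ χ p) p.K (n + 1) := rfl
variable {F N} in
/-- **THE RESIDUAL 𝐓-WEIGHT PART OF THE RUN SERVING THE HISTORY `s`** (v1.7 `H`, DESIGN (α)): at step `n` every generation reads `θ.Zh p n` at the WHOLE set-sequences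
`s.Ω`, `s.Λ` of the history. [cite: Balaban1988Convergent, p.257, (2.20)–(2.22) p.258, (3.16)–(3.20) pp.268–269; Balaban1989LargeFieldI, (0.2)–(0.3) p.176] -/
def Stage13HParams.zhAtChi (θ : Stage13HParams F N) (χ : ChiSlot F N) (p : B12.RunParams) {n : ℕ} (s : SeqOfRecord F θ.ν θ.τ9.M (gOfRecord₁₃Chi F N θ.toStage13Params χ p) p.K n) :
    TkResidualW F N (FluctV N) p.K :=
  θ.Zh p n s.Ω s.Λ

variable {F N} in
/-- **THE §2 RESIDUAL OF THE RUN SERVING THE HISTORY `s`** (v1.7 `H`, DESIGN (α); INDEX-PARITY row C2): 11c's spaces-data `bgI`, `bgMS` of the torus (`θ.Rz p.K`,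
UNCHANGED — row `bg` ∕ `BgProvisoΛ` read only these) and the smearing functions `(φ_j)_j = θ.Phih p n` at the WHOLE set-sequences `s.Ω`, `s.Λ` of the history.
[cite: Balaban1988Convergent, (2.24)–(2.25) p.259, (2.26)–(2.28) p.259, p.257] -/
def Stage13HParams.rzAtChi (θ : Stage13HParams F N) (χ : ChiSlot F N) (p : B12.RunParams) {n : ℕ} (s : SeqOfRecord F θ.ν θ.τ9.M (gOfRecord₁₃Chi F N θ.toStage13Params χ p) p.K n) :
    Sect2.Residual (F.P p.K) (MatA N) :=
  ⟨(θ.Rz p.K).bgI, (θ.Rz p.K).bgMS, θ.Phih p n s.Ω s.Λ⟩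

variable {F N}

/-- Unfolding of `zhAtChi`'s `ζ0` (`rfl`). [cite: Balaban1988Convergent, (3.16) p.268 (bookkeeping)] -/
@[simp] theorem Stage13HParams.zhAt_ζ0_chi (θ : Stage13HParams F N) (χ : ChiSlot F N) (p : B12.RunParams) {n : ℕ}
    (s : SeqOfRecord F θ.ν θ.τ9.M (gOfRecord₁₃Chi F N θ.toStage13Params χ p) p.K n) (j : ℕ) :
    (θ.zhAtChi χ p s).ζ0 j = (θ.Zh p n s.Ω s.Λ).ζ0 j := rfl

/-- Unfolding of `zhAtChi`'s `quad` (`rfl`). [cite: Balaban1988Convergent, (2.21) p.258 (bookkeeping)] -/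
@[simp] theorem Stage13HParams.zhAt_quad_chi (θ : Stage13HParams F N) (χ : ChiSlot F N) (p : B12.RunParams) {n : ℕ}
    (s : SeqOfRecord F θ.ν θ.τ9.M (gOfRecord₁₃Chi F N θ.toStage13Params χ p) p.K n) (j : ℕ) :
    (θ.zhAtChi χ p s).quad j = (θ.Zh p n s.Ω s.Λ).quad j := rfl

/-- Unfolding of `rzAtChi`'s spaces-data (`rfl`): the torus residual's. [cite: Balaban1988Convergent, (2.26)–(2.28) p.259 (bookkeeping)] -/
@[simp] theorem Stage13HParams.rzAt_bgI_chi (θ : Stage13HParams F N) (χ : ChiSlot F N) (p : B12.RunParams) {n : ℕ}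
    (s : SeqOfRecord F θ.ν θ.τ9.M (gOfRecord₁₃Chi F N θ.toStage13Params χ p) p.K n) : (θ.rzAtChi χ p s).bgI = (θ.Rz p.K).bgI := rfl

/-- (`rfl`) [cite: Balaban1988Convergent, (2.41) p.261 (bookkeeping)] -/
@[simp] theorem Stage13HParams.rzAt_bgMS_chi (θ : Stage13HParams F N) (χ : ChiSlot F N) (p : B12.RunParams) {n : ℕ}
    (s : SeqOfRecord F θ.ν θ.τ9.M (gOfRecord₁₃Chi F N θ.toStage13Params χ p) p.K n) : (θ.rzAtChi χ p s).bgMS = (θ.Rz p.K).bgMS := rfl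

/-- Unfolding of `rzAtChi`'s `φ` (`rfl`). [cite: Balaban1988Convergent, (2.24)–(2.25) p.259 (bookkeeping)] -/
@[simp] theorem Stage13HParams.rzAt_phi_chi (θ : Stage13HParams F N) (χ : ChiSlot F N) (p : B12.RunParams) {n : ℕ}
    (s : SeqOfRecord F θ.ν θ.τ9.M (gOfRecord₁₃Chi F N θ.toStage13Params χ p) p.K n) : (θ.rzAtChi χ p s).phi = θ.Phih p n s.Ω s.Λ := rfl

/-- **ROW `bg` IS HISTORY-BLIND ON THE RESIDUAL**: def-R's re-ranged background proviso at the history's residual IS the one at the torus residual (the spaces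
`U^c_j`, `Ũ^c_j` read `bgI`, `bgMS` only; `Iff.rfl`). [cite: Balaban1988Convergent, (2.26)–(2.28) p.259, (2.41) p.261 (bookkeeping)] -/
theorem Stage13HParams.bgProvisoΛ_rzAt_iff_chi (θ : Stage13HParams F N) (χ : ChiSlot F N) (p : B12.RunParams) {n : ℕ}
    (s₀ : SeqOfRecord F θ.ν θ.τ9.M (gOfRecord₁₃Chi F N θ.toStage13Params χ p) p.K n) (S : Sect2.Setting (MatA N) (SU N)) (M k : ℕ) {g : ℕ → ℝ}
    (Supp : SeqOfRecord F θ.ν M g p.K k → Set (B15DeterminingSets.MSField (F.P p.K) (SU N))) (U : SeqOfRecord F θ.ν M g p.K k → BgMap F N p.K) :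
    BgProvisoΛ F N p.K S (θ.rzAtChi χ p s₀) M k Supp U ↔ BgProvisoΛ F N p.K S (θ.Rz p.K) M k Supp U := Iff.rfl

/-- 12a's law `ζ0 ≥ 0` of the history's residual FROM the law of every `θ.Zh p n Ω Λ`. [cite: Balaban1988Convergent, p.267 (bookkeeping)] -/
theorem Stage13HParams.zhAt_laws_chi {θ : Stage13HParams F N} {χ : ChiSlot F N} (hZ : ∀ p n Ω Λ, (θ.Zh p n Ω Λ).Laws) (p : B12.RunParams) {n : ℕ}
    (s : SeqOfRecord F θ.ν θ.τ9.M (gOfRecord₁₃Chi F N θ.toStage13Params χ p) p.K n) : (θ.zhAtChi χ p s).Laws :=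
  hZ p n s.Ω s.Λ

/-- 12b's locality law of the history's residual FROM the locality law of every `θ.Zh p n Ω Λ`. [cite: Balaban1988Convergent, (3.2)–(3.3) p.265 (bookkeeping)] -/
theorem Stage13HParams.zhAt_localLaws_chi {θ : Stage13HParams F N} {χ : ChiSlot F N} (hZ : ∀ p n Ω Λ, (θ.Zh p n Ω Λ).LocalLaws) (p : B12.RunParams) {n : ℕ}
    (s : SeqOfRecord F θ.ν θ.τ9.M (gOfRecord₁₃Chi F N θ.toStage13Params χ p) p.K n) : (θ.zhAtChi χ p s).LocalLaws :=
  hZ p n s.Ω s.Λ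

/-- 11c's laws of the history's §2 residual FROM those of the torus residual (they read `bgI`, `bgMS` only). [cite: Balaban1988Convergent, (2.26)–(2.28) p.259 (bookkeeping)] -/
theorem Stage13HParams.rzAt_laws_chi {θ : Stage13HParams F N} {χ : ChiSlot F N} (hR : ∀ K, (θ.Rz K).Laws) (p : B12.RunParams) {n : ℕ}
    (s : SeqOfRecord F θ.ν θ.τ9.M (gOfRecord₁₃Chi F N θ.toStage13Params χ p) p.K n) : (θ.rzAtChi χ p s).Laws :=
  ⟨(hR p.K).bgI_Un_one, (hR p.K).bgI_Jn_one, (hR p.K).bgMS_Up_one, (hR p.K).bgMS_Jp_one⟩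

variable (F N)

/-- **THE 𝐓-WEIGHTS OF RECORD OF THE RUN `p` FOR THE HISTORY `s`, Stage 13** (v1.7 `H`; director-ym LINE №183 H1ʰ (b)): 12a″'s `tkWeightsOfRecordP` (print's `ζ`, no
χreg factor; UNTOUCHED) over the residual part serving the history, `θ.zhAtChi χ p s = θ.Zh p n s.Ω s.Λ` (DESIGN (α)) — generation `j` of `𝐓_n(s)` receives
`ζ^{(j)}({Ω_i}, {Λ_i}; Y, ω)` with `Y = Ω^c_{j+1}` (11a's `genDataOfRecord`), a function of the WHOLE history; `quad` likewise; `chiA` is 12a's (`WtOfRecord₁₃H_chiA_chi`).  The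
v1.6 weights `WtOfRecord₁₃R θ p` are the HISTORY-BLIND case (`WtOfRecord₁₃H_ofHistoryBlind`, §H1, `rfl`).
[cite: Balaban1988Convergent, p.257, (2.20)–(2.22) p.258, (3.16)–(3.21) pp.268–269, p.267, (1.11) p.248; Balaban1989LargeFieldI, (0.2)–(0.3) p.176] -/
def WtOfRecord₁₃HChi (θ : Stage13HParams F N) (χ : ChiSlot F N) (p : B12.RunParams) {n : ℕ} (s : SeqOfRecord F θ.ν θ.τ9.M (gOfRecord₁₃Chi F N θ.toStage13Params χ p) p.K n) :
    TkWeights F N (FluctV N) p.K :=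
  tkWeightsOfRecordP F N (FluctV N) θ.ν θ.A₁ p (gOfRecord₁₃Chi F N θ.toStage13Params χ p) (θ.zhAtChi χ p s)

variable {F N}

/-- 11a's weight laws hold for the run's weights for every history under the history-indexed residual law `∀ p n Ω Λ, (θ.Zh p n Ω Λ).Laws`. [cite: Balaban1988Convergent, (2.21) p.258] -/
theorem WtOfRecord₁₃H_laws_chi {θ : Stage13HParams F N} {χ : ChiSlot F N} (hZ : ∀ p n Ω Λ, (θ.Zh p n Ω Λ).Laws) (p : B12.RunParams) {n : ℕ}
    (s : SeqOfRecord F θ.ν θ.τ9.M (gOfRecord₁₃Chi F N θ.toStage13Params χ p) p.K n) : (WtOfRecord₁₃HChi F N θ χ p s).Laws :=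
  tkWeightsOfRecordP_laws (Stage13HParams.zhAt_laws_chi hZ p s)

/-- The A-side factor `chiA` of the history's weights is 12a's, the SAME for every history (`rfl`). [cite: Balaban1988Convergent, (3.21) p.269 (bookkeeping)] -/
theorem WtOfRecord₁₃H_chiA_chi (θ : Stage13HParams F N) (χ : ChiSlot F N) (p : B12.RunParams) {n : ℕ}
    (s : SeqOfRecord F θ.ν θ.τ9.M (gOfRecord₁₃Chi F N θ.toStage13Params χ p) p.K n) :
    (WtOfRecord₁₃HChi F N θ χ p s).chiA = chiAW F N (FluctV N) θ.ν θ.A₁ p (gOfRecord₁₃Chi F N θ.toStage13Params χ p) := rfl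

variable (F N)

/-- **THE bg-FREE CORE OF THE DISPLAYED PROVISOS, Stage 13, OVER THE HISTORY-INDEXED RESIDUAL 𝐓-WEIGHT SLOT** (v1.7 `H`; director-ym LINE №183 H1ʰ, FINDING №9 — v1.6 `R`'s `Stage13RParams.Provisos₁₃CoPR` with rows `zrLaws ∕ zrLocal ↦ zhLaws ∕ zhLocal`, every other row VERBATIM; v1.6's own words follow):
v1.2's `Stage13Params.Provisos₁₃Core` (`Node00/Record13.lean` §9) VERBATIM — same rows, same order: `intPiece`, `measω`, `measChi`, `zetaUnity`, `zetaAbs`, `rstep`,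
`rzLaws` — except that the two rows on the residual 𝐓-weight slot are now the laws of the HISTORY-INDEXED slot, `zhLaws : ∀ p n Ω Λ, (θ.Zh p n Ω Λ).Laws` and
`zhLocal : ∀ p n Ω Λ, (θ.Zh p n Ω Λ).LocalLaws` (12a's `TkResidualW.Laws` ∕ 12b's `TkResidualW.LocalLaws`, untouched; v1.6 had `zrLaws ∕ zrLocal` on `θ.Zr p`, 12a `ztLaws ∕ ztLocal` on `θ.Zt K`).
NO row of this structure reads `θ.Zt` or `θ.Zr` (the run-blind ∕ run-indexed slots stay fields that nothing of the `H` edition reads); row `rzLaws : ∀ K, (θ.Rz K).Laws` is UNCHANGED (11c's `Residual.Laws` read `bgI`, `bgMS` only, which the history's residual `θ.rzAtChi χ p s` shares with `θ.Rz p.K`; `φ_j` carries no displayed law).  Exactly the rows the tower ∕ datum ∕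
shadow of record READ (`tstep`, `rstep`; the laws); the separated-range provisos `Provisos₁₃SepCoPH` (FILE 28T) project to it (`.toCore`).  Rows `intPiece` ∕ `measω` ∕
`measChi` ∕ `rstep` remain THEOREMS of (H-U) and the ζ-laws at `θ.toStage13Params` (RECORD 13 §4c, unchanged).  HYPOTHESES, never admissibility clauses, never asserted.
[cite: Balaban1988Convergent, (2.7) p.255, (2.18) p.257, (2.21) p.258, (3.2)–(3.9) pp.265–266, (3.16) p.268, (3.20)–(3.21) p.269, p.267; Balaban1989LargeFieldI, (0.3)–(0.4) p.176; Balaban1987RG1, (0.13) p.254, (0.19) p.255] -/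
structure Stage13HParams.Provisos₁₃CoPHChi (θ : Stage13HParams F N) (χ : ChiSlot F N) : Prop where
  /-- the level-`k` pieces `χ_k(s)·slot_k(s)` of `ρ_k` are integrable, `k < K`, along the ₁₃ histories -/
  intPiece : ∀ (p : B12.RunParams) (k : ℕ), k < p.K → ∀ s : SeqOfRecord F θ.ν θ.τ9.M (gOfRecord₁₃Chi F N θ.toStage13Params χ p) p.K k,
    Integrable (fun U => chiSeqOfRecord F N θ.ν θ.τ9.M (gOfRecord₁₃Chi F N θ.toStage13Params χ p) p.K k s U *
      slotsOfRecord F N θ.ν θ.τ9 (EOfRecord₁₃Chi F N θ.toStage13Params χ) (wOfRecord₉ F N θ.toStage9Params) θ.ppSel p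
        (gOfRecord₁₃Chi F N θ.toStage13Params χ p) k s U) (fieldMeasure (F.P p.K) k (SU N))
  /-- (O4): the label weights `ω = a·b·ζ` are jointly measurable in `(V′, U)`, `k < K`, along the ₁₃ histories -/
  measω : ∀ (p : B12.RunParams) (k : ℕ), k < p.K → ∀ (s : SeqOfRecord F θ.ν θ.τ9.M (gOfRecord₁₃Chi F N θ.toStage13Params χ p) p.K k)
    (t : LbOfRecord F θ.ν p (gOfRecord₁₃Chi F N θ.toStage13Params χ p) k),
    Measurable (fun z : GaugeField (F.P p.K) (k + 1) (SU N) × GaugeField (F.P p.K) k (SU N) =>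
      ωOfRecord F N θ.ν θ.τ9.M p (gOfRecord₁₃Chi F N θ.toStage13Params χ p) k θ.A₁ θ.ζ s t z.2 z.1)
  /-- the new front factors `χ_{k+1}(s′)` are measurable, `k < K`, along the ₁₃ histories -/
  measChi : ∀ (p : B12.RunParams) (k : ℕ), k < p.K → ∀ s' : SeqOfRecord F θ.ν θ.τ9.M (gOfRecord₁₃Chi F N θ.toStage13Params χ p) p.K (k + 1),
    Measurable (chiSeqOfRecord F N θ.ν θ.τ9.M (gOfRecord₁₃Chi F N θ.toStage13Params χ p) p.K (k + 1) s')
  /-- the residual `ζ` resolves unity -/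
  zetaUnity : IsZetaUnity F N θ.ν θ.τ9.M θ.ζ
  /-- the residual `ζ` has `Σ |ζ| ≤ 1` -/
  zetaAbs : IsZetaAbsLeOne F N θ.ν θ.τ9.M θ.ζ
  /-- def-R's (0.3) provisos of the pre-𝐑 tower of record, INTEGRABLE FORM (`RepData.ProvisosInt`), at every level `k+1 ≤ K`, along the ₁₃ histories, at
  every instance -/
  rstep : ∀ (p : B12.RunParams) (k : ℕ) [DecidableEq (PBond (F.P p.K) (k + 1))], k < p.K →
    (towerRepOfRecord F N θ.ν θ.τ9 (slotsTOfRecord F N θ.ν θ.τ9 (EOfRecord₁₃Chi F N θ.toStage13Params χ) (wOfRecord₉ F N θ.toStage9Params) θ.ppSel)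
      θ.ppSel p (gOfRecord₁₃Chi F N θ.toStage13Params χ p) (k + 1)).toRepData.ProvisosInt
  /-- 11c's laws of the residual §2 data -/
  rzLaws : ∀ K, (θ.Rz K).Laws
  /-- (v1.7 · HISTORY-INDEXED, FINDING №9) 12a's law of the residual part of the 𝐓-weights OF THE RUN AT EVERY STEP ALONG EVERY HISTORY: `ζ0 ≥ 0` -/
  zhLaws : ∀ (p : B12.RunParams) (n : ℕ) (Ω Λ : ℕ → Set (Site (F.P p.K) 0)), (θ.Zh p n Ω Λ).Laws
  /-- (v1.7 · HISTORY-INDEXED) the locality law of the residual 𝐓-weight factor OF THE RUN AT EVERY STEP ALONG EVERY HISTORY -/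
  zhLocal : ∀ (p : B12.RunParams) (n : ℕ) (Ω Λ : ℕ → Set (Site (F.P p.K) 0)), (θ.Zh p n Ω Λ).LocalLaws
  /-- **(H-ζ) ROW** (v1.8 · director-ym №228 LOCATED-ζ · plan g87 S2-FULL): the residual fluctuation factor `ζ` of the record is jointly
  measurable in the old and new fields — the displayed bookkeeping proviso `ZetaMeasurable` (RECORD 12 measurability), until v1.7 threaded
  as a separate hypothesis `hζ`, now a ROW of every Stage-13 proviso edition.  A REAL, REQUIRED field (readers: `h.zetaMeas`); the `autoParam`
  default below only FILLS it at a construction site that omits it — from a Stage-13 proviso value of ANY edition already in hand (the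
  transports ∕ doors) or from an `hζ` in context (the from-scratch selectors) — and fails loudly with the goal displayed otherwise.
  HYPOTHESIS, never an admissibility clause, never asserted. [cite: Balaban1988Convergent, (3.16) p.268, (3.20)–(3.21) p.269 (bookkeeping)] -/
  zetaMeas : ZetaMeasurable F N θ.ζ

variable {F N}

/-- The weight laws of the run FOR EVERY HISTORY, FROM the core (row `zhLaws`). [cite: Balaban1988Convergent, (2.21) p.258 (bookkeeping)] -/
theorem Stage13HParams.Provisos₁₃CoPHChi.wtLaws {θ : Stage13HParams F N} {χ : ChiSlot F N} (h : θ.Provisos₁₃CoPHChi F N χ) (p : B12.RunParams) {n : ℕ}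
    (s : SeqOfRecord F θ.ν θ.τ9.M (gOfRecord₁₃Chi F N θ.toStage13Params χ p) p.K n) : (WtOfRecord₁₃HChi F N θ χ p s).Laws :=
  WtOfRecord₁₃H_laws_chi h.zhLaws p s

/-- 11c's laws of the run's §2 residual FOR EVERY HISTORY, FROM the core (row `rzLaws`). [cite: Balaban1988Convergent, (2.26)–(2.28) p.259 (bookkeeping)] -/
theorem Stage13HParams.Provisos₁₃CoPHChi.rzAtLaws {θ : Stage13HParams F N} {χ : ChiSlot F N} (h : θ.Provisos₁₃CoPHChi F N χ) (p : B12.RunParams) {n : ℕ}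
    (s : SeqOfRecord F θ.ν θ.τ9.M (gOfRecord₁₃Chi F N θ.toStage13Params χ p) p.K n) : (θ.rzAtChi χ p s).Laws :=
  Stage13HParams.rzAt_laws_chi h.rzLaws p s

/-- **def-T's step provisos FROM the core** at every step `k < K` (v1.2's `Provisos₁₃Core.tstep` verbatim at `θ.toStage13Params`; the step provisos do not read the residual 𝐓-weight slot). [cite: Balaban1988Convergent, (3.2)–(3.9) pp.265–266, (3.16) p.268, (3.24)–(3.25) p.270] -/
theorem Stage13HParams.Provisos₁₃CoPHChi.tstep {θ : Stage13HParams F N} {χ : ChiSlot F N} (h : θ.Provisos₁₃CoPHChi F N χ) (p : B12.RunParams) (k : ℕ) (hk : k < p.K) :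
    TStepProvisos F N θ.ν θ.τ9 (EOfRecord₁₃Chi F N θ.toStage13Params χ) (wOfRecord₉ F N θ.toStage9Params) θ.ppSel p
      (gOfRecord₁₃Chi F N θ.toStage13Params χ p) k where
  intPiece := h.intPiece p k hk
  measW := fun s' => measurable_wOfRecord F N θ.ν θ.τ9.M θ.A₁ θ.ζ p (gOfRecord₁₃Chi F N θ.toStage13Params χ p) k (h.measω p k hk) s'
  absW_le := fun s' U V' => abs_wOfRecord_le_one F N θ.ν θ.τ9.M θ.A₁ h.zetaAbs p (gOfRecord₁₃Chi F N θ.toStage13Params χ p) k s' U V'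
  measChi := h.measChi p k hk
  unity := isStepUnity_wOfRecord F N θ.ν θ.τ9.M θ.A₁ h.zetaUnity p (gOfRecord₁₃Chi F N θ.toStage13Params χ p) k

variable (F N)

/-! ## §1 (H). THE FORM SIDE OF RECORD 13 OVER THE RUN'S 𝐓-WEIGHTS PER HISTORY `WtOfRecord₁₃HChi θ p s` AND THE HISTORY'S §2 RESIDUAL `θ.rzAtChi χ p s`: the (2.18) form
`S218OfRecord₁₃CoPHChi`, the laws 𝐒 ∕ 𝐓 (`SLaw₁₃CoPHChi ∕ TLaw₁₃CoPHChi`, now over the history-indexed predicates `HasSect2FormAEZS ∕ TAEZS` of §0a — SITE RULE S₇), the 𝐑-carriers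
`VOfRecord₁₃CoPHChi`, the residual, the Stage-5 view `Stage13HParams.toStage5₁₃CoPH`, the core `coreOfRecord₁₃CoPHChi` — every v1.6 statement of FILE 25 §1 VERBATIM under T₇
(the background `UbgOfRecord₁₃CoPChi` and the supports are CITED from FILE 23 at `θ.toStage13Params`: they read neither residual slot) -/

section FormSideCoPH

/-- **THE §2 [III] FORMAT PREDICATE OF RECORD, Stage 13** for step-`j` densities of the run `p`: represented by `rep_j` of record AND the post-𝐑 slot family of record
has the REPAIRED §2 form at index `j` — at the ₁₃ setting, weights, background maps and slots. [cite: Balaban1988Convergent, (2.17)–(2.18) p.257, (2.23)–(2.42) pp.258–261, Thm 1 p.262] -/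
def S218OfRecord₁₃CoPHChi (θ : Stage13HParams F N) (χ : ChiSlot F N) (p : B12.RunParams) (j : ℕ) (σ : Density (F.P p.K) j (SU N)) : Prop :=
  (reprOfRecord₁₃Chi F N θ.toStage13Params χ p j).Holds σ ∧
    HasSect2FormAEZS F N (FluctV N) p.K (settingOfRecord₁₃Chi F N θ.toStage13Params χ p) j (θ.rzAtChi χ p) (WtOfRecord₁₃HChi F N θ χ p)
      (UbgOfRecord₁₃CoPChi F N θ.toStage13Params χ p j)
      (slotsOfRecord F N θ.ν θ.τ9 (EOfRecord₁₃Chi F N θ.toStage13Params χ) (wOfRecord₉ F N θ.toStage9Params) θ.ppSel p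
        (gOfRecord₁₃Chi F N θ.toStage13Params χ p) j)

/-- **THE «CORRESPONDING SPACE» PREDICATE OF RECORD, Stage 13** for the 𝐓-image at step `k+1`. [cite: Balaban1988Convergent, remark p.262, Def. p.279, (3.25) p.270] -/
def ScorrLawOfRecord₁₃CoPHChi (θ : Stage13HParams F N) (χ : ChiSlot F N) (p : B12.RunParams) (k : ℕ) (σ' : Density (F.P p.K) (k + 1) (SU N)) : Prop :=
  (reprTOfRecord₁₃Chi F N θ.toStage13Params χ p k).Holds σ' ∧
    HasSect2FormTAEZS F N (FluctV N) p.K (settingOfRecord₁₃Chi F N θ.toStage13Params χ p) k (θ.rzAtChi χ p) (WtOfRecord₁₃HChi F N θ χ p)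
      (UbgOfRecord₁₃CoPChi F N θ.toStage13Params χ p (k + 1))
      (slotsTOfRecord F N θ.ν θ.τ9 (EOfRecord₁₃Chi F N θ.toStage13Params χ) (wOfRecord₉ F N θ.toStage9Params) θ.ppSel p
        (gOfRecord₁₃Chi F N θ.toStage13Params χ p) (k + 1))

/-- **`SLaw₁₃CoPHChi θ p j`** — `S218OfRecord₁₃CoPHChi` READ AT `densOfRecord₁₃Chi`. [cite: Balaban1988Convergent, (2.18) p.257, Thm 1 p.262] -/
def SLaw₁₃CoPHChi (θ : Stage13HParams F N) (χ : ChiSlot F N) (p : B12.RunParams) (j : ℕ) : Prop :=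
  S218OfRecord₁₃CoPHChi F N θ χ p j (densOfRecord₁₃Chi F N θ.toStage13Params χ p j)

/-- **`TLaw₁₃CoPHChi θ p k`** — `ScorrLawOfRecord₁₃CoPHChi` READ AT `tdensOfRecord₁₃Chi`. [cite: Balaban1988Convergent, remark p.262, Def. p.279] -/
def TLaw₁₃CoPHChi (θ : Stage13HParams F N) (χ : ChiSlot F N) (p : B12.RunParams) (k : ℕ) : Prop :=
  ScorrLawOfRecord₁₃CoPHChi F N θ χ p k (tdensOfRecord₁₃Chi F N θ.toStage13Params χ p k)

/-- `SLaw₁₃CoPHChi` IS the repaired §2 form of the post-𝐑 slot family (the representation clause holds by construction). [cite: Balaban1988Convergent, (2.18) p.257, Thm 1 p.262] -/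
theorem sLaw₁₃CoPH_iff_chi (θ : Stage13HParams F N) (χ : ChiSlot F N) (p : B12.RunParams) (j : ℕ) :
    SLaw₁₃CoPHChi F N θ χ p j ↔ HasSect2FormAEZS F N (FluctV N) p.K (settingOfRecord₁₃Chi F N θ.toStage13Params χ p) j (θ.rzAtChi χ p) (WtOfRecord₁₃HChi F N θ χ p)
      (UbgOfRecord₁₃CoPChi F N θ.toStage13Params χ p j)
      (slotsOfRecord F N θ.ν θ.τ9 (EOfRecord₁₃Chi F N θ.toStage13Params χ) (wOfRecord₉ F N θ.toStage9Params) θ.ppSel p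
        (gOfRecord₁₃Chi F N θ.toStage13Params χ p) j) :=
  ⟨fun h => h.2, fun h => ⟨holds_densOfRecord₁₃_chi F N θ.toStage13Params χ p j, h⟩⟩

/-- `TLaw₁₃CoPHChi` IS the repaired 𝐓-image form of the pre-𝐑 slot family. [cite: Balaban1988Convergent, remark p.262, (3.25) p.270] -/
theorem tLaw₁₃CoPH_iff_chi (θ : Stage13HParams F N) (χ : ChiSlot F N) (p : B12.RunParams) (k : ℕ) :
    TLaw₁₃CoPHChi F N θ χ p k ↔ HasSect2FormTAEZS F N (FluctV N) p.K (settingOfRecord₁₃Chi F N θ.toStage13Params χ p) k (θ.rzAtChi χ p) (WtOfRecord₁₃HChi F N θ χ p)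
      (UbgOfRecord₁₃CoPChi F N θ.toStage13Params χ p (k + 1))
      (slotsTOfRecord F N θ.ν θ.τ9 (EOfRecord₁₃Chi F N θ.toStage13Params χ) (wOfRecord₉ F N θ.toStage9Params) θ.ppSel p
        (gOfRecord₁₃Chi F N θ.toStage13Params χ p) (k + 1)) :=
  ⟨fun h => h.2, fun h => ⟨holds_tdensOfRecord₁₃_chi F N θ.toStage13Params χ p k, h⟩⟩

/-- **THE BASE IS A THEOREM** at Stage 13, history-indexed data: the level-0 post-𝐑 slot family HAS the repaired §2 form for EVERY `θ` and run — §0a's GENERIC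
`hasSect2FormAEZS_zero_of_bg_readsScaleZero` (n13-e's level-0 base over history-indexed residual ∕ weights: any setting whose flow starts at `g 0`, any background
map reading the scale-0 variables), identity branch. [cite: Balaban1988Convergent, Thm 1 p.262, (2.18) p.257, (2.23)–(2.24) pp.258–259] -/
theorem sLaw₁₃CoPH_zero_chi (θ : Stage13HParams F N) (χ : ChiSlot F N) (p : B12.RunParams) : SLaw₁₃CoPHChi F N θ χ p 0 :=
  (sLaw₁₃CoPH_iff_chi F N θ χ p 0).mpr
    (hasSect2FormAEZS_zero_of_bg_readsScaleZero p (settingOfRecord₁₃Chi F N θ.toStage13Params χ p) θ.ν θ.τ9 (θ.rzAtChi χ p) (WtOfRecord₁₃HChi F N θ χ p)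
      (EOfRecord₁₃Chi F N θ.toStage13Params χ) (wOfRecord₉ F N θ.toStage9Params) θ.ppSel rfl (U := UbgOfRecord₁₃CoPChi F N θ.toStage13Params χ p 0) (fun _ _ => rfl))

/-- … so at level 0 the format predicate of record IS the representation clause. [cite: Balaban1988Convergent, Thm 1 p.262, (2.18) p.257 (bookkeeping)] -/
theorem s218OfRecord₁₃CoPH_zero_iff_chi (θ : Stage13HParams F N) (χ : ChiSlot F N) (p : B12.RunParams) (σ : Density (F.P p.K) 0 (SU N)) :
    S218OfRecord₁₃CoPHChi F N θ χ p 0 σ ↔ (reprOfRecord₁₃Chi F N θ.toStage13Params χ p 0).Holds σ :=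
  ⟨fun h => h.1, fun h => ⟨h, (sLaw₁₃CoPH_zero_chi F N θ χ p).2⟩⟩

/-- **ABSENT SLOTS PASS**: if every post-𝐑 slot of record at level `j` is the zero function, `SLaw₁₃CoPHChi θ p j` holds under the signs `0 ≤ E₀, B₀` and a nonnegative
history up to `j` (§0a's `hasSect2FormAEZS_of_forall_eq_zero`). [cite: Balaban1988Convergent, (2.17) p.257; Balaban1987RG1, (0.20) p.256] -/
theorem sLaw₁₃CoPH_of_forall_slot_eq_zero_chi (θ : Stage13HParams F N) (χ : ChiSlot F N) (p : B12.RunParams) (j : ℕ)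
    (h0 : ∀ s, slotsOfRecord F N θ.ν θ.τ9 (EOfRecord₁₃Chi F N θ.toStage13Params χ) (wOfRecord₉ F N θ.toStage9Params) θ.ppSel p
      (gOfRecord₁₃Chi F N θ.toStage13Params χ p) j s = 0)
    (hE₀ : 0 ≤ θ.s2.lf.E₀) (hB₀ : 0 ≤ θ.s2.lf.B₀) (hg : ∀ i, i ≤ j → 0 ≤ gOfRecord₁₃Chi F N θ.toStage13Params χ p i) : SLaw₁₃CoPHChi F N θ χ p j :=
  (sLaw₁₃CoPH_iff_chi F N θ χ p j).mpr
    (hasSect2FormAEZS_of_forall_eq_zero p.K _ j _ _ _ h0 (settingOfRecord₁₃_satisfiesRG_chi F N θ.toStage13Params χ p j) hE₀ hB₀ hg)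

/-- **THE 𝐑-CARRIERS OF THE RUN `p`, Stage 13**: target space `S j ρ :↔ ρ = ρ_j ∧ SLaw₁₃CoPHChi θ p j`, corresponding space `Scorr (k+1) ρ' :↔ ρ' = 𝐓ρ_k ∧ TLaw₁₃CoPHChi θ p k`,
`Scorr 0 :≡ ⊥`, induced `R`. [cite: Balaban1988Convergent, p.244 and remark p.262; Balaban1989LargeFieldI, (0.2)–(0.3) p.176] -/
def VOfRecord₁₃CoPHChi (θ : Stage13HParams F N) (χ : ChiSlot F N) (p : B12.RunParams) : PrintedCarriers14R where
  P := F.P p.K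
  G := SU N
  instGG := inferInstance
  instMS := inferInstance
  instHD := inferInstance
  K := p.K
  R := fun k => inducedAt (tdensOfRecord₁₃Chi F N θ.toStage13Params χ p k) (densOfRecord₁₃Chi F N θ.toStage13Params χ p (k + 1))
  Scorr := fun j ρ' => match j with
    | 0 => False
    | k + 1 => ρ' = tdensOfRecord₁₃Chi F N θ.toStage13Params χ p k ∧ TLaw₁₃CoPHChi F N θ χ p k
  S := fun j ρ => ρ = densOfRecord₁₃Chi F N θ.toStage13Params χ p j ∧ SLaw₁₃CoPHChi F N θ χ p j

/-- The pinned density operation maps `𝐓ρ_k ↦ ρ_{k+1}`. [cite: Balaban1989LargeFieldI, (0.2)–(0.3) p.176 (bookkeeping)] -/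
theorem R_VOfRecord₁₃CoPH_tdens_chi (θ : Stage13HParams F N) (χ : ChiSlot F N) (p : B12.RunParams) (k : ℕ) :
    (VOfRecord₁₃CoPHChi F N θ χ p).R k (tdensOfRecord₁₃Chi F N θ.toStage13Params χ p k) = densOfRecord₁₃Chi F N θ.toStage13Params χ p (k + 1) :=
  inducedAt_self _ _

/-- **[III] p. 244's LEAF AT THE STAGE-13 CARRIERS**: `ROpLeaf (VOfRecord₁₃CoPHChi θ p) ↔ ∀ k < K, TLaw₁₃CoPHChi θ p k → SLaw₁₃CoPHChi θ p (k+1)`.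
[cite: Balaban1988Convergent, p.244, Thm 2 p.263 and remark p.262 (bookkeeping)] -/
theorem rOpLeaf_VOfRecord₁₃CoPH_iff_chi (θ : Stage13HParams F N) (χ : ChiSlot F N) (p : B12.RunParams) :
    ROpLeaf (VOfRecord₁₃CoPHChi F N θ χ p) ↔ ∀ k, k < p.K → TLaw₁₃CoPHChi F N θ χ p k → SLaw₁₃CoPHChi F N θ χ p (k + 1) := by
  rw [rOpLeaf_iff]
  refine ⟨fun h k hk hT => ?_, fun h k hk ρ' hρ' => ?_⟩
  · have hS := h k hk (tdensOfRecord₁₃Chi F N θ.toStage13Params χ p k) ⟨rfl, hT⟩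
    rw [R_VOfRecord₁₃CoPH_tdens_chi] at hS
    exact hS.2
  · obtain ⟨rfl, hT⟩ := hρ'
    show (VOfRecord₁₃CoPHChi F N θ χ p).S (k + 1) ((VOfRecord₁₃CoPHChi F N θ χ p).R k (tdensOfRecord₁₃Chi F N θ.toStage13Params χ p k))
    rw [R_VOfRecord₁₃CoPH_tdens_chi]
    exact ⟨rfl, h k hk hT⟩

/-- **THE STAGE-13 RESIDUAL**: Stage 8's residual with the 𝐑-carriers `VOfRecord₁₃CoPHChi`, the β RE-POINT `βfun := betaOfRecord₁₃` (the χ-generic β at `TcanOfRecord` and the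
(2.9) species), `E`, `χ := chiβOfRecord₁₃ θ` along `gOfRecord₁₃Chi`, the four action∕format fields over def-B's transport-generic layer AT `TβOfRecord₁₃ = TcanOfRecord`
and `chiβOfRecord₁₃ θ`, and `S218 := S218OfRecord₁₃CoPHChi` PINNED.
[cite: Balaban1988Convergent, p.244, (2.18) p.257; Balaban1989LargeFieldI, (0.2)–(0.6) pp.176–177; Balaban1987RG1, (0.19) p.255, p.259 (dictionary; bookkeeping)] -/
def residualOfStage13CoPHChi (θ : Stage13HParams F N) (χ : ChiSlot F N) : Residual₅ F N :=
  { residualOfStage8 F N θ.toStage8Params with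
    V := VOfRecord₁₃CoPHChi F N θ χ
    βfun := betaOfRecord₁₃Chi F N θ.toStage13Params χ
    χ := fun p k => χ p.K (gOfRecord₁₃Chi F N θ.toStage13Params χ p) k
    E := EOfRecord₁₃Chi F N θ.toStage13Params χ
    effAction := effActionOfRecordT F N (TβOfRecord₁₃ F N) (χ) (betaOfRecord₁₃Chi F N θ.toStage13Params χ)
    Ek := EkOfRecordT F N (TβOfRecord₁₃ F N) (χ) θ.εbg (betaOfRecord₁₃Chi F N θ.toStage13Params χ)
    ReprA := ReprAOfRecordT F N (TβOfRecord₁₃ F N) (χ) θ.εbg (betaOfRecord₁₃Chi F N θ.toStage13Params χ)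
    IndA := IndAOfRecordT F N (TβOfRecord₁₃ F N) (χ) θ.εbg (betaOfRecord₁₃Chi F N θ.toStage13Params χ)
    S218 := S218OfRecord₁₃CoPHChi F N θ χ }

/-- **The Stage-5 VIEW of Stage-13 parameters, Stage-13 residual**. [cite: Balaban1989LargeFieldII, Thm 1 p.355 (bookkeeping)] -/
def Stage13HParams.toStage5₁₃CoPHChi (θ : Stage13HParams F N) (χ : ChiSlot F N) : Stage5Params F N :=
  { θ.toStage5Params with res := residualOfStage13CoPHChi F N θ χ }

/-- The view's 𝐑-carriers ARE the pinned ones (`rfl`). [cite: Balaban1988Convergent, p.244 (bookkeeping)] -/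
theorem Stage13HParams.toStage5₁₃CoPH_res_V_chi (θ : Stage13HParams F N) (χ : ChiSlot F N) (p : B12.RunParams) : (θ.toStage5₁₃CoPHChi F N χ).res.V p = VOfRecord₁₃CoPHChi F N θ χ p := rfl

/-- The view's format slot IS the Stage-13 predicate of record (`rfl`). [cite: Balaban1988Convergent, (2.18) p.257 (bookkeeping)] -/
theorem Stage13HParams.toStage5₁₃CoPH_res_S218_chi (θ : Stage13HParams F N) (χ : ChiSlot F N) : (θ.toStage5₁₃CoPHChi F N χ).res.S218 = S218OfRecord₁₃CoPHChi F N θ χ := rfl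

/-- The view's β-functions ARE `betaOfRecord₁₃ θ` (`rfl`). [cite: Balaban1987RG1, (1.20)–(1.22) p.264 (bookkeeping)] -/
theorem Stage13HParams.toStage5₁₃CoPH_res_βfun_chi (θ : Stage13HParams F N) (χ : ChiSlot F N) : (θ.toStage5₁₃CoPHChi F N χ).res.βfun = betaOfRecord₁₃Chi F N θ.toStage13Params χ := rfl

/-- **THE RECORD'S 𝐑-LEAF, UNFOLDED** at the C-binding of record over the Stage-13 view. [cite: Balaban1988Convergent, p.244 and Thm 2 p.263; Balaban1989LargeFieldII, Thm 1 p.355 (bookkeeping)] -/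
theorem rOperation_upOfRecord₅C_stage13CoPH_iff_chi (θ : Stage13HParams F N) (χ : ChiSlot F N) (p : B12.RunParams) :
    (upOfRecord₅C F N (θ.toStage5₁₃CoPHChi F N χ) p).rOperation ↔ ∀ k, k < p.K → TLaw₁₃CoPHChi F N θ χ p k → SLaw₁₃CoPHChi F N θ χ p (k + 1) := by
  show ROpLeaf (VOfRecord₁₃CoPHChi F N θ χ p) ↔ _
  exact rOpLeaf_VOfRecord₁₃CoPH_iff_chi F N θ χ p

/-- **THE CORE OF RECORD at `θ`, Stage 13** (`RGMachineCore`, by hand, as FILE 10's `coreOfRecord₁₀` with `TcOfRecord ↦ TβOfRecord₁₃ = TcanOfRecord`, `chiFixed7 ↦ chiβOfRecord₁₃ θ = chiFixed29 θ.ν θ.ε₂₉` and the ₁₃ plugs):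
`Sect2Form p k := S218OfRecord₁₃CoPHChi θ p k ρ_k` READ AT `densOfRecord₁₃Chi`. [cite: Balaban1987RG1, (0.17)–(0.24) pp.255–257, p.259; Balaban1988Convergent, (2.17)–(2.18) p.257, Thm 1 p.262 (dictionary; bookkeeping)] -/
def coreOfRecord₁₃CoPHChi (θ : Stage13HParams F N) (χ : ChiSlot F N) : RGMachineCore F (SU N) where
  βfun := betaOfRecord₁₃Chi F N θ.toStage13Params χ
  E := EOfRecord₁₃Chi F N θ.toStage13Params χ
  dom := fun p k => domAltOfRecord F N θ.ν p.K k
  effAction := effActionOfRecordT F N (TβOfRecord₁₃ F N) (χ) (betaOfRecord₁₃Chi F N θ.toStage13Params χ)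
  wilsonBG := wilsonBGOfRecord F N θ.εbg
  Ek := EkOfRecordT F N (TβOfRecord₁₃ F N) (χ) θ.εbg (betaOfRecord₁₃Chi F N θ.toStage13Params χ)
  χ := fun p k => χ p.K (gOfRecord₁₃Chi F N θ.toStage13Params χ p) k
  Repr := fun p k => ReprAOfRecordT F N (TβOfRecord₁₃ F N) (χ) θ.εbg (betaOfRecord₁₃Chi F N θ.toStage13Params χ) p k
    (prefixOf (gOfRecord₁₃Chi F N θ.toStage13Params χ p) k) (domAltOfRecord F N θ.ν p.K k)
    (effActionOfRecordT F N (TβOfRecord₁₃ F N) (χ) (betaOfRecord₁₃Chi F N θ.toStage13Params χ) p k)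
    (wilsonBGOfRecord F N θ.εbg p k) (EkOfRecordT F N (TβOfRecord₁₃ F N) (χ) θ.εbg (betaOfRecord₁₃Chi F N θ.toStage13Params χ) p k)
  IndAss := fun p k => IndAOfRecordT F N (TβOfRecord₁₃ F N) (χ) θ.εbg (betaOfRecord₁₃Chi F N θ.toStage13Params χ) p k
    (prefixOf (gOfRecord₁₃Chi F N θ.toStage13Params χ p) k) (domAltOfRecord F N θ.ν p.K k)
    (effActionOfRecordT F N (TβOfRecord₁₃ F N) (χ) (betaOfRecord₁₃Chi F N θ.toStage13Params χ) p k)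
    (wilsonBGOfRecord F N θ.εbg p k) (EkOfRecordT F N (TβOfRecord₁₃ F N) (χ) θ.εbg (betaOfRecord₁₃Chi F N θ.toStage13Params χ) p k)
  Sect2Form := fun p k => S218OfRecord₁₃CoPHChi F N θ χ p k (densOfRecord₁₃Chi F N θ.toStage13Params χ p k)

/-- The core's Wilson start IS `ρ₀` of record. [cite: Balaban1988Convergent, Thm 1 p.262 (bookkeeping)] -/
theorem rhoZero_coreOfRecord₁₃CoPH_chi (θ : Stage13HParams F N) (χ : ChiSlot F N) (p : B12.RunParams) :
    (coreOfRecord₁₃CoPHChi F N θ χ).rhoZero p = densOfRecord₁₃Chi F N θ.toStage13Params χ p 0 := by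
  rw [densOfRecord₁₃_zero_chi]
  rfl

/-- The core's §2 clause IS `SLaw₁₃CoPHChi` (`Iff.rfl`). [cite: Balaban1988Convergent, (2.18) p.257, Thm 1 p.262 (bookkeeping)] -/
theorem sect2Form_coreOfRecord₁₃CoPH_iff_chi (θ : Stage13HParams F N) (χ : ChiSlot F N) (p : B12.RunParams) (k : ℕ) :
    (coreOfRecord₁₃CoPHChi F N θ χ).Sect2Form p k ↔ SLaw₁₃CoPHChi F N θ χ p k := Iff.rfl

/-- The core's β IS the χ-generic β at the canonical-version transport and the (2.9) species (`rfl`). [cite: Balaban1987RG1, (1.20)–(1.22) p.264 (bookkeeping)] -/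
theorem βfun_coreOfRecord₁₃CoPH_chi (θ : Stage13HParams F N) (χ : ChiSlot F N) :
    (coreOfRecord₁₃CoPHChi F N θ χ).βfun = betaOfRecord₈Tχ F N (TcanOfRecord F N) χ θ.toStage8Params := rfl

end FormSideCoPH
/-! ## §2 (H). THE bg-FREE CORE TOWER ∕ DATUM keyed on `Provisos₁₃CoPHChi` (§0b); rfl faces — FILE 25 §2 VERBATIM under T₇ -/

section CoreTowerCoPH

open Classical in
/-- **THE TOWER OF RECORD at `θ` keyed on the bg-free CORE, AT PRINT'S BACKGROUND** (v1.7 `H` image of the Co twin of v1.2's `towerOfRecord₁₃Core`), BY HAND exactly as it (which reads `h` only through `tstep` ∕ `rstep`).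
[cite: Balaban1988Convergent, (0.2) p.244, (2.18) p.257, (3.25) p.270; Balaban1989LargeFieldI, (0.4) p.176] -/
def towerOfRecord₁₃CoPHChi (θ : Stage13HParams F N) (χ : ChiSlot F N) (h : θ.Provisos₁₃CoPHChi F N χ) : (coreOfRecord₁₃CoPHChi F N θ χ).Tower (avOfRecord F N) where
  ρ := fun p k => densOfRecord₁₃Chi F N θ.toStage13Params χ p k
  Trho := fun p k => tdensOfRecord₁₃Chi F N θ.toStage13Params χ p k
  rho_zero := fun p => (rhoZero_coreOfRecord₁₃CoPH_chi F N θ χ p).symm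
  isRT_Trho := fun p k hk => isRT_trhoOfRecord9 F N θ.ν θ.τ9 (EOfRecord₁₃Chi F N θ.toStage13Params χ) (wOfRecord₉ F N θ.toStage9Params) θ.ppSel p
    (gOfRecord₁₃Chi F N θ.toStage13Params χ p) k hk (h.tstep p k hk)
  integral_succ := fun p k hk => integral_densOfRecord₁₃_succ_chi F N θ.toStage13Params χ p k (h.rstep p k hk)

/-- **THE DATUM OF RECORD keyed on the bg-free CORE, Stage 13, AT PRINT'S BACKGROUND** (v1.7 `H` image of the Co twin of v1.2's `datumOfRecord₁₃Core`). [cite: Balaban1989LargeFieldII, Thm 1 + (0.1) pp.355–356; Balaban1988Convergent, (0.2) p.244] -/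
def datumOfRecord₁₃CoPHChi (θ : Stage13HParams F N) (χ : ChiSlot F N) (h : θ.Provisos₁₃CoPHChi F N χ) : FiniteEpsData F (SU N) :=
  datumOfTower F N (coreOfRecord₁₃CoPHChi F N θ χ) (towerOfRecord₁₃CoPHChi F N θ χ h)

/-- FACE `dens` of the core-keyed Co datum (`rfl`). [cite: Balaban1988Convergent, (2.18) p.257 (bookkeeping)] -/
theorem dens_datumOfRecord₁₃CoPH_chi (θ : Stage13HParams F N) (χ : ChiSlot F N) (h : θ.Provisos₁₃CoPHChi F N χ) (K : ℕ) (g₀ : ℝ) (k : ℕ) :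
    (datumOfRecord₁₃CoPHChi F N θ χ h).dens K g₀ k = densOfRecord₁₃Chi F N θ.toStage13Params χ ⟨K, F.m, g₀⟩ k := rfl

/-- FACE construction of the core-keyed Co datum (`rfl`). [cite: Balaban1989LargeFieldII, Thm 1 + (0.1) pp.355–356 (bookkeeping)] -/
theorem datumOfRecord₁₃CoPH_C_chi (θ : Stage13HParams F N) (χ : ChiSlot F N) (h : θ.Provisos₁₃CoPHChi F N χ) :
    (datumOfRecord₁₃CoPHChi F N θ χ h).C = (coreOfRecord₁₃CoPHChi F N θ χ).construction (densOfRecord₁₃Chi F N θ.toStage13Params χ) := rfl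

/-- FACE β of the core-keyed Co datum (`rfl`). [cite: Balaban1987RG1, (1.20)–(1.22) p.264 (bookkeeping)] -/
theorem βfun_datumOfRecord₁₃CoPH_chi (θ : Stage13HParams F N) (χ : ChiSlot F N) (h : θ.Provisos₁₃CoPHChi F N χ) :
    (datumOfRecord₁₃CoPHChi F N θ χ h).βfun = betaOfRecord₁₃Chi F N θ.toStage13Params χ := rfl

/-- FACE flow of the core-keyed Co datum (`rfl`). [cite: Balaban1987RG1, (0.17)–(0.20) pp.255–256 (bookkeeping)] -/
theorem flow_g_datumOfRecord₁₃CoPH_chi (θ : Stage13HParams F N) (χ : ChiSlot F N) (h : θ.Provisos₁₃CoPHChi F N χ) (p : B12.RunParams) :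
    ((datumOfRecord₁₃CoPHChi F N θ χ h).C p).flow.g = gOfRecord₁₃Chi F N θ.toStage13Params χ p := rfl

/-- FACE av of the core-keyed Co datum (`rfl`). [cite: Balaban1987RG1, (0.4) p.253 (bookkeeping)] -/
theorem av_datumOfRecord₁₃CoPH_chi (θ : Stage13HParams F N) (χ : ChiSlot F N) (h : θ.Provisos₁₃CoPHChi F N χ) : (datumOfRecord₁₃CoPHChi F N θ χ h).av = avOfRecord F N := rfl

/-- STAGE-0 DATUM CLAUSE at the core-keyed Co datum (`rfl`). [cite: Balaban1987RG1, (0.3)–(0.4) p.253] -/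
theorem isDatumOfRecord₀_datumOfRecord₁₃CoPH_chi (θ : Stage13HParams F N) (χ : ChiSlot F N) (h : θ.Provisos₁₃CoPHChi F N χ) :
    IsDatumOfRecord₀ F N (datumOfRecord₁₃CoPHChi F N θ χ h) := rfl

/-- BINDER B1 = NODE N23 at the core-keyed Co datum. [cite: Balaban1987RG1, (0.4) p.253] -/
theorem isPrintedAveraged_datumOfRecord₁₃CoPH_chi (θ : Stage13HParams F N) (χ : ChiSlot F N) (h : θ.Provisos₁₃CoPHChi F N χ) : (datumOfRecord₁₃CoPHChi F N θ χ h).IsPrintedAveraged :=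
  isPrintedAveraged_datumOfTower F N _ _

end CoreTowerCoPH
/-! ## §3 (H). THE CORE RECORD FAMILY (bg-free) over the history-indexed slot: tower ∕ datum faces, [V] Thm 1 induction sockets, the record predicate
`IsRecordOfRecord₁₃CCoPH` (`∃ (θ : Stage13HParams F N) (h : θ.Provisos₁₃CoPHChi F N χ), …`), its consequences, the Stage-5 shadow, the node sockets, the β-layer faces — FILE 25 §3 VERBATIM under T₇ -/

section CoreRecordCoPH

/-- (v1.7 `H` · Co · bg-FREE PROVISO CORE) The tower's densities ARE `densOfRecord₁₃Chi` (`rfl`). [cite: Balaban1988Convergent, (2.18) p.257 (bookkeeping)] -/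
theorem towerOfRecord₁₃CoPH_ρ_chi (θ : Stage13HParams F N) (χ : ChiSlot F N) (h : θ.Provisos₁₃CoPHChi F N χ) (p : B12.RunParams) (k : ℕ) :
    (towerOfRecord₁₃CoPHChi F N θ χ h).ρ p k = densOfRecord₁₃Chi F N θ.toStage13Params χ p k := rfl

/-- (v1.7 `H` · Co · bg-FREE PROVISO CORE) The tower's `𝐓ρ_k` ARE `tdensOfRecord₁₃Chi` (`rfl`). [cite: Balaban1988Convergent, (3.25) p.270 (bookkeeping)] -/
theorem towerOfRecord₁₃CoPH_Trho_chi (θ : Stage13HParams F N) (χ : ChiSlot F N) (h : θ.Provisos₁₃CoPHChi F N χ) (p : B12.RunParams) (k : ℕ) :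
    (towerOfRecord₁₃CoPHChi F N θ χ h).Trho p k = tdensOfRecord₁₃Chi F N θ.toStage13Params χ p k := rfl

/-- (v1.7 `H` · Co · bg-FREE PROVISO CORE) `ρ₀` of the tower is integrable on every run: `e^{−E(p)}` times the Wilson–Boltzmann weight (`Missing.integrable_boltzmann`). [cite: Balaban1988Convergent, Thm 1 p.262 (bookkeeping)] -/
theorem integrable_towerOfRecord₁₃CoPH_ρ_zero_chi (θ : Stage13HParams F N) (χ : ChiSlot F N) (h : θ.Provisos₁₃CoPHChi F N χ) (p : B12.RunParams) :
    Integrable ((towerOfRecord₁₃CoPHChi F N θ χ h).ρ p 0) (fieldMeasure (F.P p.K) 0 (SU N)) := by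
  rw [(towerOfRecord₁₃CoPHChi F N θ χ h).rho_zero p]
  exact (Missing.integrable_boltzmann RegularGaugeGroup.measurable_reTr (F.P p.K) (sq_nonneg _)).const_mul _

open Classical in
/-- (v1.7 `H` · Co · bg-FREE PROVISO CORE) `ρ_{k+1}` of the tower is integrable, `k < K`: the (0.3)-density of the R-stepped pre-𝐑 slot under the integrable-form `rstep` (def-R's
`integrable_densityOfSlice_rstepSlotOfRecord_of_provisosInt`). [cite: Balaban1989LargeFieldI, (0.3)–(0.4) p.176 (bookkeeping)] -/
theorem integrable_towerOfRecord₁₃CoPH_ρ_succ_chi (θ : Stage13HParams F N) (χ : ChiSlot F N) (h : θ.Provisos₁₃CoPHChi F N χ) (p : B12.RunParams) (k : ℕ) (hk : k < p.K) :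
    Integrable ((towerOfRecord₁₃CoPHChi F N θ χ h).ρ p (k + 1)) (fieldMeasure (F.P p.K) (k + 1) (SU N)) := by
  rw [towerOfRecord₁₃CoPH_ρ_chi, densOfRecord₁₃_succ_chi]
  exact integrable_densityOfSlice_rstepSlotOfRecord_of_provisosInt F N θ.ν θ.τ9 _ θ.ppSel p _ (k + 1) (h.rstep p k hk)

/-- (v1.7 `H` · Co · bg-FREE PROVISO CORE) **THE TOWER OF RECORD IS INTEGRABLE** (`RGMachineCore.Tower.IsIntegrable`): every `ρ_k`, `k ≤ K`, from the displayed provisos alone. [cite: Balaban1988Convergent, (0.2) p.244 (bookkeeping)] -/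
theorem isIntegrable_towerOfRecord₁₃CoPH_chi (θ : Stage13HParams F N) (χ : ChiSlot F N) (h : θ.Provisos₁₃CoPHChi F N χ) : (towerOfRecord₁₃CoPHChi F N θ χ h).IsIntegrable
  | p, 0, _ => integrable_towerOfRecord₁₃CoPH_ρ_zero_chi F N θ χ h p
  | p, k + 1, hk => integrable_towerOfRecord₁₃CoPH_ρ_succ_chi F N θ χ h p k (Nat.lt_of_succ_le hk)

/-- (v1.7 `H` · Co · bg-FREE PROVISO CORE) … and every `𝐓ρ_k`, `k < K`, is integrable (def-T's `integrable_piece_trhoOfRecord9` summed). [cite: Balaban1988Convergent, (3.25) p.270 (bookkeeping)] -/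
theorem integrable_towerOfRecord₁₃CoPH_Trho_chi (θ : Stage13HParams F N) (χ : ChiSlot F N) (h : θ.Provisos₁₃CoPHChi F N χ) (p : B12.RunParams) (k : ℕ) (hk : k < p.K) :
    Integrable ((towerOfRecord₁₃CoPHChi F N θ χ h).Trho p k) (fieldMeasure (F.P p.K) (k + 1) (SU N)) :=
  integrable_finsetSum Finset.univ (fun s' _ => integrable_piece_trhoOfRecord9 F N θ.ν θ.τ9 (EOfRecord₁₃Chi F N θ.toStage13Params χ) (wOfRecord₉ F N θ.toStage9Params)
    θ.ppSel p (gOfRecord₁₃Chi F N θ.toStage13Params χ p) k hk (h.tstep p k hk) s')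

/-- (v1.7 `H` · Co · bg-FREE PROVISO CORE) FACE `Trho` (`rfl`). [cite: Balaban1988Convergent, (3.25) p.270 (bookkeeping)] -/
theorem trho_datumOfRecord₁₃CoPH_chi (θ : Stage13HParams F N) (χ : ChiSlot F N) (h : θ.Provisos₁₃CoPHChi F N χ) (K : ℕ) (g₀ : ℝ) (k : ℕ) :
    (datumOfRecord₁₃CoPHChi F N θ χ h).real.Trho K g₀ k = tdensOfRecord₁₃Chi F N θ.toStage13Params χ ⟨K, F.m, g₀⟩ k := rfl

/-- (v1.7 `H` · Co · bg-FREE PROVISO CORE) FACE `𝐑` (`rfl`). [cite: Balaban1989LargeFieldI, (0.2)–(0.3) p.176 (bookkeeping)] -/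
theorem R_datumOfRecord₁₃CoPH_eq_VOfRecord₁₃CoPH_chi (θ : Stage13HParams F N) (χ : ChiSlot F N) (h : θ.Provisos₁₃CoPHChi F N χ) (K : ℕ) (g₀ : ℝ) (k : ℕ) :
    (datumOfRecord₁₃CoPHChi F N θ χ h).real.R K g₀ k = (VOfRecord₁₃CoPHChi F N θ χ ⟨K, F.m, g₀⟩).R k := rfl

/-- (v1.7 `H` · Co · bg-FREE PROVISO CORE) … and maps `𝐓ρ_k ↦ ρ_{k+1}`. [cite: Balaban1988Convergent, (0.2) p.244; Balaban1989LargeFieldI, (0.3) p.176] -/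
theorem R_tdens_datumOfRecord₁₃CoPH_chi (θ : Stage13HParams F N) (χ : ChiSlot F N) (h : θ.Provisos₁₃CoPHChi F N χ) (K : ℕ) (g₀ : ℝ) (k : ℕ) :
    (datumOfRecord₁₃CoPHChi F N θ χ h).real.R K g₀ k (tdensOfRecord₁₃Chi F N θ.toStage13Params χ ⟨K, F.m, g₀⟩ k) =
      densOfRecord₁₃Chi F N θ.toStage13Params χ ⟨K, F.m, g₀⟩ (k + 1) :=
  (towerOfRecord₁₃CoPHChi F N θ χ h).inducedR_Trho ⟨K, F.m, g₀⟩ k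

/-- (v1.7 `H` · Co · bg-FREE PROVISO CORE) … i.e. the χ-generic β at `T := TcanOfRecord`, `χ := chiFixed29 θ.ν θ.ε₂₉` (`rfl`). [cite: Balaban1987RG1, (1.20)–(1.22) p.264, (2.9) p.266 (bookkeeping)] -/
theorem βfun_datumOfRecord₁₃CoPH_eq_betaOfRecord₈Tχ_chi (θ : Stage13HParams F N) (χ : ChiSlot F N) (h : θ.Provisos₁₃CoPHChi F N χ) :
    (datumOfRecord₁₃CoPHChi F N θ χ h).βfun = betaOfRecord₈Tχ F N (TcanOfRecord F N) χ θ.toStage8Params := rfl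
end CoreRecordCoPH

/-! ## §R. RECEIPTS at `χ := chiβOfRecord₁₃ θ.toStage13Params` (defs: `rfl`; Prop-structures: field-wise `Iff`) and §A the Ax instances -/

section ReceiptsCoPH
variable {F N}
variable (θ : Stage13HParams F N)

/-- Receipt: the χ-generic CoPH 𝐓-weights at the record's β-slot ARE the record's (definitional). [cite: Balaban1988Convergent, (3.23) p.270 (bookkeeping)] -/
theorem WtOfRecord₁₃HChi_chiβ (p : B12.RunParams) {n : ℕ} (s : SeqOfRecord F θ.ν θ.τ9.M (gOfRecord₁₃ F N θ.toStage13Params p) p.K n) :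
    WtOfRecord₁₃HChi F N θ (chiβOfRecord₁₃ F N θ.toStage13Params) p s = WtOfRecord₁₃H F N θ p s := rfl

/-- Receipt: the χ-generic CoPH core at the record's β-slot IS the record's core (definitional). [cite: Balaban1988Convergent, Thm 1 p.262 (bookkeeping)] -/
theorem coreOfRecord₁₃CoPHChi_chiβ : coreOfRecord₁₃CoPHChi F N θ (chiβOfRecord₁₃ F N θ.toStage13Params) = coreOfRecord₁₃CoPH F N θ := rfl

/-- Receipt: the χ-generic CoPH residual∕view at the record's β-slot IS the record's (definitional). [cite: Balaban1989LargeFieldI, (0.2)–(0.3) p.176 (bookkeeping)] -/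
theorem toStage5₁₃CoPHChi_chiβ : θ.toStage5₁₃CoPHChi F N (chiβOfRecord₁₃ F N θ.toStage13Params) = θ.toStage5₁₃CoPH F N := rfl

/-- Receipt: the χ-generic CoPH provisos at the record's β-slot are the record's provisos, field for field. [cite: Balaban1988Convergent, (2.18) p.257 (bookkeeping)] -/
theorem provisos₁₃CoPHChi_chiβ_iff : θ.Provisos₁₃CoPHChi F N (chiβOfRecord₁₃ F N θ.toStage13Params) ↔ θ.Provisos₁₃CoPH F N :=
  ⟨fun h => ⟨h.intPiece, h.measω, h.measChi, h.zetaUnity, h.zetaAbs, h.rstep, h.rzLaws, h.zhLaws, h.zhLocal, h.zetaMeas⟩,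
   fun h => ⟨h.intPiece, h.measω, h.measChi, h.zetaUnity, h.zetaAbs, h.rstep, h.rzLaws, h.zhLaws, h.zhLocal, h.zetaMeas⟩⟩

/-- Receipt: the χ-generic CoPH datum at the record's β-slot IS the record's datum (definitional through the proviso receipt). [cite: Balaban1988Convergent, Thm 1 p.262 (bookkeeping)] -/
theorem datumOfRecord₁₃CoPHChi_chiβ (h : θ.Provisos₁₃CoPH F N) :
    datumOfRecord₁₃CoPHChi F N θ (chiβOfRecord₁₃ F N θ.toStage13Params) ((provisos₁₃CoPHChi_chiβ_iff θ).2 h) = datumOfRecord₁₃CoPH F N θ h := rfl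

end ReceiptsCoPH

/-- **The CoPH provisos, RE-CENTRED** (instance `χ := chiβOfRecord₁₃Ax θ`). [cite: Balaban1988Convergent, (2.18) p.257, Thm 1 p.262] -/
abbrev Stage13HParams.Provisos₁₃CoPHAx (θ : Stage13HParams F N) : Prop := θ.Provisos₁₃CoPHChi F N (chiβOfRecord₁₃Ax F N θ.toStage13Params)

/-- **The CoPH datum, RE-CENTRED**. [cite: Balaban1988Convergent, Thm 1 p.262] -/
abbrev datumOfRecord₁₃CoPHAx (θ : Stage13HParams F N) (h : θ.Provisos₁₃CoPHAx F N) : FiniteEpsData F (SU N) :=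
  datumOfRecord₁₃CoPHChi F N θ (chiβOfRecord₁₃Ax F N θ.toStage13Params) h

end Literature.MathematicalPhysics.QuantumFieldTheory.Balaban1983to89.Node00

end
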